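import Summits.CriticalPhenomena.CardyFormulaZ2.Theorems.CardySelfRefinementLagHandOffReduction
import HarnessLib

/-!
# `LagHandOff` (stmt-CriticalPhenomena-10268) — the typed SPLIT into two route-level children

Strategist seat planner-cstrat-stmt-CriticalPhenomena-10268-s2-0 (crux-strategist protocol (b),
2026-08-17).  The crux `CardySelfRefinement.LagHandOff` is, by the landed reduction
`HittingTournament.lagHandOff_of_quadTransfer_limitMarkov` (this directory, …Reduction.lean,
p127346; nine lead seats c0–c7 and two strategist seats behind it), EXACTLY the conjunction of
two statements that are open in print for `ℤ²` subsequential limits: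

* `QuadInterfaceTransfer` (= R1 `stub_quadTransfer`): ONE Borel, exactly similarity-equivariant
  quad → interface decoder `Ψ D : ℋ_ℂ → CurveClass ℂ` such that (configuration, interface) →
  `(S, Ψ D S)` jointly in law for every Dobrushin domain and every admissible
  `ℤ²`-discretisation family along every positive null mesh sequence on which the full-plane
  quad-crossing laws converge (Garban–Pete–Schramm 2013, arXiv:1008.1378, Question 10 p. 16 in
  the joint form of Cor. 9, for `ℤ²` sublimits; on `𝕋` Holden–Sun arXiv:1905.13207 Prop. 6.25);
* `SublimitDomainMarkov` (= R2′ `stub_limitMarkov`): the chordal family pinned by a quad sublimit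
  is domain Markov in the tree's set-based sense (Werner 2007 §3.2 (2); nothing in print for `ℤ²`
  sublimits: Smirnov ICM 2006 §4.2, GPS13 p. 16).

This file is the glue `LagHandOff_of_subs : QuadInterfaceTransfer → SublimitDomainMarkov →
LagHandOff` for the route edit `--split LagHandOff --into QuadInterfaceTransfer
SublimitDomainMarkov`, with the two children written EXACTLY as they are filed as route items:
the route file `Theses/CardySelfRefinement.lean` imports only fact-free vocabulary
(`QuadCrossingSpace`, `InterfaceCurves`, `DobrushinDiscretisation`, `ChordalCurveFamily`) and NOT
`Literature/Probability/Percolation/QuadCrossingSpaceZ2.lean`, so the two abbreviations of that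
module are unfolded one definitional step in the children —
`z2QuadConfig univ δ ω := configOf Site.toComplex δ univ (ω ∩ (zdGraph 2).edgeSet)` and
`z2QuadLaw univ δ := ⟨P_½.map (z2QuadConfig univ δ), inferInstance⟩` — and fully qualified.
`quadInterfaceTransfer_iff_stub` / `sublimitDomainMarkov_iff_stub` record (by `Iff.rfl`) that the
children ARE the registered stubs R1 / R2′ verbatim up to this unfolding, so every landed helper
of lines `hitting-tournament` / `mushroom-transfer` (≈ 130 files, namespaces
`…Cruxes.LagHandOff.HittingTournament` / `.MushroomTransfer` / `.CrosscutDictionary`) serves the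
children unchanged, and the kernel package K1 `stub_closeEncounter`, K2 `stub_noBoundaryPinch`,
K3 `stub_sixArm` with the conditional assemblies K4 `stub_quadTransfer_of_kernel` (→ child 1) and
K5 `stub_limitMarkov_of_kernel` (→ child 2) of `Cruxes/LagHandOff/Lines/mushroom_transfer.lean`
is the registered skeleton material of the two children.
-/

noncomputable section

open MeasureTheory Filter Set Topology
open scoped unitInterval BoundedContinuousFunction
open Literature.Probability.Percolation Literature.Probability.LatticeModels
open Literature.Probability.RandomPlanarGeometry Literature.Probability.Percolation.QuadCrossing
open Summit.CriticalPhenomena.CardyFormulaZ2.Theses.CardySelfRefinement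

namespace Summit.CriticalPhenomena.CardyFormulaZ2.Cruxes.LagHandOff.Split

open Summit.CriticalPhenomena.CardyFormulaZ2.Cruxes.LagHandOff.HittingTournament

/-- **Child 1 is R1.**  The route-level statement `QuadInterfaceTransfer` (left, exactly as filed
in the route file: fully qualified, `z2QuadLaw` / `z2QuadConfig` unfolded one step) is
definitionally the registered stub `HittingTournament.stub_quadTransfer` (right). -/
theorem quadInterfaceTransfer_iff_stub :
    (open MeasureTheory Filter Literature.Probability.Percolation Literature.Probability.LatticeModels Literature.Probability.RandomPlanarGeometry Literature.Probability.Percolation.QuadCrossing in ∃ Ψ : DobrushinDomain → QuadConfig (Set.univ : Set ℂ) → CurveClass ℂ, (∀ D : DobrushinDomain, Measurable (Ψ D)) ∧ (∀ (D : DobrushinDomain) (c : ℂ) (hc : c ≠ 0) (w : ℂ) (S : QuadConfig (Set.univ : Set ℂ)), Ψ (D.map (similarity c hc w)) (S.mapHomeomorph (similarity c hc w)) = (Ψ D S).map (similarity c hc w : C(ℂ, ℂ))) ∧ (∀ (μ : FiniteMeasure (QuadConfig (Set.univ : Set ℂ))) (δs : ℕ → ℝ), (∀ n, 0 < δs n)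 → Tendsto δs atTop (nhds 0) → Tendsto (β := FiniteMeasure (QuadConfig (Set.univ : Set ℂ))) (fun n => ⟨(bondPercolation (zdGraph 2) half).map (fun ω => configOf Site.toComplex (δs n) (Set.univ : Set ℂ) (ω ∩ (zdGraph 2).edgeSet)), inferInstance⟩) atTop (nhds μ) → ∀ (D : DobrushinDomain) (E : ℝ → DiscreteDobrushin), ZdDiscretisationFamily D E → ∀ f : BoundedContinuousFunction (QuadConfig (Set.univ : Set ℂ) × CurveClass ℂ) ℝ, Tendsto (fun n => ∫ ω, f (configOf Site.toComplex (δs n) (Set.univ : Set ℂ) (ω ∩ (zdGraph 2).edgeSet), bondInterfaceIn D (E (δs n)) ω) ∂(bondPercolation (zdGraph 2) half)) atTop (nhds (∫ S, f (S, Ψ D S) ∂(μ : Measure (QuadConfig (Set.univ : Set ℂ))))))) ↔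
    (∃ Ψ : DobrushinDomain → QuadConfig (Set.univ : Set ℂ) → CurveClass ℂ,
      (∀ D : DobrushinDomain, Measurable (Ψ D)) ∧
      (∀ (D : DobrushinDomain) (c : ℂ) (hc : c ≠ 0) (w : ℂ) (S : QuadConfig (Set.univ : Set ℂ)),
        Ψ (D.map (similarity c hc w)) (S.mapHomeomorph (similarity c hc w)) =
          (Ψ D S).map (similarity c hc w : C(ℂ, ℂ))) ∧
      (∀ (μ : FiniteMeasure (QuadConfig (Set.univ : Set ℂ))) (δs : ℕ → ℝ), (∀ n, 0 < δs n) →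
        Tendsto δs atTop (𝓝 0) →
        Tendsto (fun n => z2QuadLaw (Set.univ : Set ℂ) (δs n)) atTop (𝓝 μ) →
        ∀ (D : DobrushinDomain) (E : ℝ → DiscreteDobrushin), ZdDiscretisationFamily D E →
          ∀ f : (QuadConfig (Set.univ : Set ℂ) × CurveClass ℂ) →ᵇ ℝ,
            Tendsto (fun n => ∫ ω, f (z2QuadConfig (Set.univ : Set ℂ) (δs n) ω,
                bondInterfaceIn D (E (δs n)) ω) ∂(bondPercolation (zdGraph 2) half))
              atTop (𝓝 (∫ S, f (S, Ψ D S) ∂(μ : Measure (QuadConfig (Set.univ : Set ℂ))))))) :=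
  Iff.rfl

/-- **Child 2 is R2′.**  The route-level statement `SublimitDomainMarkov` (left, as filed) is
definitionally the stub `stub_limitMarkov` (right; the hypothesis `hR2` of
`lagHandOff_of_quadTransfer_limitMarkov`). -/
theorem sublimitDomainMarkov_iff_stub :
    (open MeasureTheory Filter Literature.Probability.Percolation Literature.Probability.LatticeModels Literature.Probability.RandomPlanarGeometry Literature.Probability.Percolation.QuadCrossing in ∀ μ ∈ subseqQuadLimits (Set.univ : Set ℂ), ∀ P : ChordalFamily, (∀ δs : ℕ → ℝ, (∀ n, 0 < δs n) → Tendsto δs atTop (nhds 0) → Tendsto (β := FiniteMeasure (QuadConfig (Set.univ : Set ℂ))) (fun n => ⟨(bondPercolation (zdGraph 2) half).map (fun ω => configOf Site.toComplex (δs n) (Set.univ : Set ℂ) (ω ∩ (zdGraph 2).edgeSet)), inferInstance⟩) atTop (nhds μ) → ∀ (D : DobrushinDomain) (E : ℝ → DiscreteDobrushin), ZdDiscretisationFamily D E → ∀ f : BoundedContinuousFunction (CurveClass ℂ) ℝ, Tendsto (fun n => ∫ ω, f (bondInterfaceIn D (E (δs n)) ω) ∂(bondPercolation (zdGraph 2)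 half)) atTop (nhds (∫ γ, f γ ∂(P D)))) → (∀ D : DobrushinDomain, ∃ E : ℝ → DiscreteDobrushin, ZdDiscretisationFamily D E) → P.IsDomainMarkov) ↔
    (∀ μ ∈ subseqQuadLimits (Set.univ : Set ℂ), ∀ P : ChordalFamily,
      (∀ δs : ℕ → ℝ, (∀ n, 0 < δs n) → Tendsto δs atTop (𝓝 0) →
        Tendsto (fun n => z2QuadLaw (Set.univ : Set ℂ) (δs n)) atTop (𝓝 μ) →
        ∀ (D : DobrushinDomain) (E : ℝ → DiscreteDobrushin), ZdDiscretisationFamily D E →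
          ∀ f : CurveClass ℂ →ᵇ ℝ,
            Tendsto (fun n => ∫ ω, f (bondInterfaceIn D (E (δs n)) ω)
              ∂(bondPercolation (zdGraph 2) half)) atTop (𝓝 (∫ γ, f γ ∂(P D)))) →
      (∀ D : DobrushinDomain, ∃ E : ℝ → DiscreteDobrushin, ZdDiscretisationFamily D E) →
      P.IsDomainMarkov) :=
  Iff.rfl

/-- **The split glue `LagHandOff_of_subs : QuadInterfaceTransfer → SublimitDomainMarkov →
LagHandOff`** (children exactly as filed in the route), by the landed reduction
`lagHandOff_of_quadTransfer_limitMarkov` (p127346: clause (i) outright; one SS11 subsequence at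
the quad level; `P := (Ψ ·)_* μ`; chordality, similarity covariance — the only use of the two
antecedents `RotationInput`, `ScaleInvariantLimits` —, locality / target independence,
discretisability and no-boundary-tracing all landed; domain Markov from child 2). -/
theorem LagHandOff_of_subs : (open MeasureTheory Filter Literature.Probability.Percolation Literature.Probability.LatticeModels Literature.Probability.RandomPlanarGeometry Literature.Probability.Percolation.QuadCrossing in ∃ Ψ : DobrushinDomain → QuadConfig (Set.univ : Set ℂ) → CurveClass ℂ, (∀ D : DobrushinDomain, Measurable (Ψ D)) ∧ (∀ (D : DobrushinDomain) (c : ℂ) (hc : c ≠ 0) (w : ℂ) (S : QuadConfig (Set.univ : Set ℂ)), Ψ (D.map (similarity c hc w)) (S.mapHomeomorph (similarity c hc w)) = (Ψ D S).map (similarity c hc w : C(ℂ, ℂ))) ∧ (∀ (μ : FiniteMeasure (QuadConfig (Set.univ : Set ℂ))) (δs : ℕ → ℝ), (∀ n, 0 < δs n) → Tendsto δs atTop (nhds 0) → Tendsto (β := FiniteMeasure (QuadConfig (Set.univ : Set ℂ))) (fun n => ⟨(bondPercolation (zdGraph 2) half).map (fun ω => configOf Site.toComplex (δs n) (Set.univ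 : Set ℂ) (ω ∩ (zdGraph 2).edgeSet)), inferInstance⟩) atTop (nhds μ) → ∀ (D : DobrushinDomain) (E : ℝ → DiscreteDobrushin), ZdDiscretisationFamily D E → ∀ f : BoundedContinuousFunction (QuadConfig (Set.univ : Set ℂ) × CurveClass ℂ) ℝ, Tendsto (fun n => ∫ ω, f (configOf Site.toComplex (δs n) (Set.univ : Set ℂ) (ω ∩ (zdGraph 2).edgeSet), bondInterfaceIn D (E (δs n)) ω) ∂(bondPercolation (zdGraph 2) half)) atTop (nhds (∫ S, f (S, Ψ D S) ∂(μ : Measure (QuadConfig (Set.univ : Set ℂ))))))) → (open MeasureTheory Filter Literature.Probability.Percolation Literature.Probability.LatticeModels Literature.Probability.RandomPlanarGeometry Literature.Probability.Percolation.QuadCrossing in ∀ μ ∈ subseqQuadLimits (Set.univ : Set ℂ), ∀ P : ChordalFamily, (∀ δs : ℕ → ℝ, (∀ n, 0 < δs n) → Tendsto δs atTop (nhds 0) → Tendsto (β := FiniteMeasure (QuadConfig (Set.univ : Set ℂ))) (fun n => ⟨(bondPercolation (zdGraph 2) half).map (fun ω => configOf Site.toComplex (δs n) (Set.univ : Set ℂ)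 (ω ∩ (zdGraph 2).edgeSet)), inferInstance⟩) atTop (nhds μ) → ∀ (D : DobrushinDomain) (E : ℝ → DiscreteDobrushin), ZdDiscretisationFamily D E → ∀ f : BoundedContinuousFunction (CurveClass ℂ) ℝ, Tendsto (fun n => ∫ ω, f (bondInterfaceIn D (E (δs n)) ω) ∂(bondPercolation (zdGraph 2) half)) atTop (nhds (∫ γ, f γ ∂(P D)))) → (∀ D : DobrushinDomain, ∃ E : ℝ → DiscreteDobrushin, ZdDiscretisationFamily D E) → P.IsDomainMarkov) → Summit.CriticalPhenomena.CardyFormulaZ2.Theses.CardySelfRefinement.LagHandOff :=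
  fun h1 h2 => lagHandOff_of_quadTransfer_limitMarkov h1 h2

end Summit.CriticalPhenomena.CardyFormulaZ2.Cruxes.LagHandOff.Split

end
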